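import Summits.MatrixMultiplication.MatrixMultiplication.Theorems.OutsiderSandwichColumnDisjoint
import HarnessLib

/-!
# Column-disjoint sign-untwisted certificates have LINEAR delay: `8^N ≤ B · 6^M`

Route `OutsiderSandwich` (decomposition cell `decomp-mm`, lens 4 «minimal counterexample /
extremal reduction», gen 27), support for the aside leaf `BlockOneIsMM`
(stmt-MatrixMultiplication-27147, `⟺ θ⋆ = 0 ⟺` SUBLINEAR DELAY, `blockOneIsMM_iff_sublinearDelay`
of `OutsiderSandwichDelayLadder`); the cut of record `closes(LaserTangency, LaserMergeOptimal,
SummitIffLaserTangency)` is untouched.  Two-level form of `OutsiderSandwichColumnDisjoint`.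

## Content

The certificates of `OutsiderSandwichColumnDisjoint` had resource and target at the same level
`N`.  Here the resource is `⟨B⟩ ⊠ C₁^{⊠M}` (blocks `τ_c(A_i X)`, `c ∈ (ℤ/2)^M`, `A_i X` a
`2^M × 2^M` matrix) and the target `⟨2,2,2⟩^{⊠N} = ⟨2^N, 2^N, 2^N⟩` (columns `d ∈ (ℤ/2)^N`, `X` a
`2^N × 2^N` matrix) — the shape of a DELAYED certificate `C₁^{⊠(N+p)} ⊵ ⟨2,2,2⟩^{⊠N}` (`B = 1`,
`M = N + p`) and of a helped one (`M = N`).  Column-disjoint (each block wired to at most one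
target column, `col i c`) and sign-untwisted (`τ_c ∘ A_i = ε • A_i` on used blocks) as before.

* `four_pow_le_sum_finrank₂` — per column, `4^N ≤ Σ_{blocks b serving d} rank A_{i_b}` (joint
  injectivity of the serving `x`-leg maps).
* `eight_pow_le_card_mul_six_pow` — **CD ∧ SU ⟹ `8^N ≤ B · 6^M`**: the `2^N` columns need
  `2^N · 4^N = 8^N` dimensions, a copy supplies `|C_i| · rank A_i ≤ 6^M` (capacity law at level
  `M`, `OutsiderSandwichTwistCapacity`).  At `M = N` this is `4^N ≤ B · 3^N`
  (`OutsiderSandwichColumnDisjoint.four_pow_le_card_mul_three_pow`, landed).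
* `delay_linear_of_cdsu` — **the delay of a CD ∧ SU certificate is LINEAR**: a one-copy
  certificate `C₁^{⊠(N+p)} ⊵ ⟨2,2,2⟩^{⊠N}` in the class forces `8^N ≤ 6^(N+p)`, i.e.
  `p · log 6 ≥ N · log (4/3)` (`delay_rate_of_cdsu`; rate `≥ 0.1605…`); e.g. no CD ∧ SU certificate
  for `Delayed 7 1` (`6^8 < 8^7`, `no_cdsu_delayed_seven_one`).

Reading for the leaf (honest): `BlockOneIsMM ⟺` sublinear delay EXISTS; this file does not touch
that — it says a sublinear-delay WITNESS, if column-disjoint, uses a genuinely twisted block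
(`exists_twisted_block₂`), else shares blocks between columns.  It is a no-go for a certificate
CLASS (where a proof of the leaf cannot live), not evidence against the leaf.
No definition, no instance, no Literature notion is introduced.

## References

* M. Bläser, *Fast Matrix Multiplication*, Theory of Computing Graduate Surveys 5 (2013), §5,
  Def. 7.2. [Blaser2013]
* D. Coppersmith, S. Winograd, *Matrix multiplication via arithmetic progressions*,
  J. Symb. Comp. 9 (1990), §7. [CoppersmithWinograd1990]
* J.-P. Serre, *Linear Representations of Finite Groups*, GTM 42 (1977), §2.3, Ex. 2.6.
  [Serre1977]
-/

noncomputable section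

open scoped BigOperators Matrix

set_option linter.dupNamespace false
set_option autoImplicit false

namespace Summit.MatrixMultiplication.MatrixMultiplication.Theorems.OutsiderSandwichColumnDisjointDelay

open Summit.MatrixMultiplication.MatrixMultiplication.Theorems.OutsiderSandwichTwistGluing
  Summit.MatrixMultiplication.MatrixMultiplication.Theorems.OutsiderSandwichTwistCapacity
  Summit.MatrixMultiplication.MatrixMultiplication.Theorems.OutsiderSandwichColumnDisjoint

universe u v

variable {N M : ℕ} {K : Type u} [Field K] {ι : Type v} [Fintype ι]

/-! ## 1. Per column (two levels) -/

/-- **Per-column rank count, two levels.**  If the blocks `b = (i, c)` of `T` (`c ∈ (ℤ/2)^M`)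
reproduce the `2^N × 2^N` matrix `X` on one target column through vector-leg matrices of shapes
`2^N × 2^M` and `2^M × 2^N`, then `4^N ≤ Σ_{b ∈ T} rank A_{i_b}`. -/
theorem four_pow_le_sum_finrank₂
    (A : ι → Matrix (Idx N) (Idx N) K →ₗ[K] Matrix (Idx M) (Idx M) K)
    (G : ι → Idx M → Matrix (Idx N) (Idx M) K) (H : ι → Idx M → Matrix (Idx M) (Idx N) K)
    (T : Finset (ι × Idx M))
    (ident : ∀ X, ∑ b ∈ T, G b.1 b.2 * ptrans b.2 (A b.1 X) * H b.1 b.2 = X) :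
    4 ^ N ≤ ∑ b ∈ T, Module.finrank K (LinearMap.range (A b.1)) := by
  classical
  let φ : Matrix (Idx N) (Idx N) K →ₗ[K] ((b : T) → LinearMap.range (A b.1.1)) :=
    LinearMap.pi fun b => (A b.1.1).rangeRestrict
  have hφ : Function.Injective φ := by
    intro X X' h
    have hA : ∀ b ∈ T, A b.1 X = A b.1 X' := fun b hb => by
      have h1 := congrFun h ⟨b, hb⟩
      simp only [φ, LinearMap.pi_apply] at h1
      simpa only [LinearMap.codRestrict_apply] using congrArg Subtype.val h1
    calc X = ∑ b ∈ T, G b.1 b.2 * ptrans b.2 (A b.1 X) * H b.1 b.2 := (ident X).symm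
      _ = ∑ b ∈ T, G b.1 b.2 * ptrans b.2 (A b.1 X') * H b.1 b.2 :=
          Finset.sum_congr rfl fun b hb => by rw [hA b hb]
      _ = X' := ident X'
  calc 4 ^ N = Module.finrank K (Matrix (Idx N) (Idx N) K) := finrank_matrix_Idx.symm
    _ ≤ Module.finrank K ((b : T) → LinearMap.range (A b.1.1)) :=
        LinearMap.finrank_le_finrank_of_injective hφ
    _ = ∑ b : T, Module.finrank K (LinearMap.range (A b.1.1)) := Module.finrank_pi_fintype K
    _ = ∑ b ∈ T, Module.finrank K (LinearMap.range (A b.1)) :=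
        Finset.sum_coe_sort T fun b => Module.finrank K (LinearMap.range (A b.1))

/-! ## 2. `8^N ≤ B · 6^M` -/

/-- **CD ∧ SU ⟹ `8^N ≤ B · 6^M`** (resource `⟨B⟩ ⊠ C₁^{⊠M}`, target `⟨2,2,2⟩^{⊠N}`): the
column-disjoint certificate (`x`-leg maps `A i` into `2^M × 2^M` matrices, block `(i, c)` wired
to column `col i c`, vector-leg matrices `G i c`, `H i c`, column identities `ident`) all of whose
used blocks are sign-untwisted (`hSU`) satisfies `8^N ≤ card ι · 6^M`. -/
theorem eight_pow_le_card_mul_six_pow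
    (A : ι → Matrix (Idx N) (Idx N) K →ₗ[K] Matrix (Idx M) (Idx M) K)
    (col : ι → Idx M → Option (Idx N))
    (G : ι → Idx M → Matrix (Idx N) (Idx M) K) (H : ι → Idx M → Matrix (Idx M) (Idx N) K)
    (ident : ∀ (d : Idx N) (X : Matrix (Idx N) (Idx N) K),
      ∑ b ∈ Finset.univ.filter (fun b : ι × Idx M => col b.1 b.2 = some d),
        G b.1 b.2 * ptrans b.2 (A b.1 X) * H b.1 b.2 = X)
    (hSU : ∀ i c, col i c ≠ none → ∃ ε : K, ∀ X, ptrans c (A i X) = ε • A i X) :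
    8 ^ N ≤ Fintype.card ι * 6 ^ M := by
  classical
  let rk : ι → ℕ := fun i => Module.finrank K (LinearMap.range (A i))
  let C : ι → Finset (Idx M) := fun i => Finset.univ.filter fun c => col i c ≠ none
  have hcol : ∀ d : Idx N, 4 ^ N ≤
      ∑ b ∈ Finset.univ.filter (fun b : ι × Idx M => col b.1 b.2 = some d), rk b.1 :=
    fun d => four_pow_le_sum_finrank₂ A G H _ (ident d)
  have hfib : ∀ b : ι × Idx M,
      ∑ d : Idx N, (if col b.1 b.2 = some d then rk b.1 else 0) =
        if col b.1 b.2 ≠ none then rk b.1 else 0 := by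
    intro b
    cases hb : col b.1 b.2 with
    | none => simp
    | some d₀ =>
        simp only [Option.some.injEq, ne_eq, reduceCtorEq, not_false_eq_true, if_true]
        rw [Finset.sum_ite_eq Finset.univ d₀ (fun _ => rk b.1), if_pos (Finset.mem_univ _)]
  have hsum : ∑ d : Idx N,
      ∑ b ∈ Finset.univ.filter (fun b : ι × Idx M => col b.1 b.2 = some d), rk b.1 =
        ∑ i, (C i).card * rk i := by
    calc ∑ d : Idx N, ∑ b ∈ Finset.univ.filter (fun b : ι × Idx M => col b.1 b.2 = some d), rk b.1
        = ∑ d : Idx N, ∑ b : ι × Idx M, (if col b.1 b.2 = some d then rk b.1 else 0) :=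
          Finset.sum_congr rfl fun d _ => Finset.sum_filter _ _
      _ = ∑ b : ι × Idx M, ∑ d : Idx N, (if col b.1 b.2 = some d then rk b.1 else 0) :=
          Finset.sum_comm
      _ = ∑ b : ι × Idx M, (if col b.1 b.2 ≠ none then rk b.1 else 0) :=
          Finset.sum_congr rfl fun b _ => hfib b
      _ = ∑ i, ∑ c : Idx M, (if col i c ≠ none then rk i else 0) :=
          Fintype.sum_prod_type _
      _ = ∑ i, (C i).card * rk i := Finset.sum_congr rfl fun i _ => by
          rw [← Finset.sum_filter, Finset.sum_const, smul_eq_mul]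
  -- capacity law at level `M` (for the range of `A i`, a map between DIFFERENT levels)
  have hcap : ∀ i, (C i).card * rk i ≤ 6 ^ M := fun i =>
    card_mul_finrank_le (LinearMap.range (A i)) (C i) fun c hc => by
      obtain ⟨ε, hε⟩ := hSU i c (Finset.mem_filter.1 hc).2
      exact ⟨ε, fun Y hY => by obtain ⟨X, rfl⟩ := LinearMap.mem_range.1 hY; exact hε X⟩
  calc 8 ^ N = 2 ^ N * 4 ^ N := by rw [← mul_pow]; norm_num
    _ = ∑ _d : Idx N, 4 ^ N := by rw [Finset.sum_const, Finset.card_univ, card_Idx, smul_eq_mul]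
    _ ≤ ∑ d : Idx N,
          ∑ b ∈ Finset.univ.filter (fun b : ι × Idx M => col b.1 b.2 = some d), rk b.1 :=
        Finset.sum_le_sum fun d _ => hcol d
    _ = ∑ i, (C i).card * rk i := hsum
    _ ≤ ∑ _i : ι, 6 ^ M := Finset.sum_le_sum fun i _ => hcap i
    _ = Fintype.card ι * 6 ^ M := by rw [Finset.sum_const, Finset.card_univ, smul_eq_mul]

/- At equal levels `M = N` the bound `8^N ≤ B · 6^N` is `4^N ≤ B · 3^N`, already landed as
`OutsiderSandwichColumnDisjoint.four_pow_le_card_mul_three_pow` (not restated here). -/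

/-- **Extremal reading, two levels**: a column-disjoint certificate with `card ι · 6^M < 8^N`
uses a genuinely twisted block. -/
theorem exists_twisted_block₂
    (A : ι → Matrix (Idx N) (Idx N) K →ₗ[K] Matrix (Idx M) (Idx M) K)
    (col : ι → Idx M → Option (Idx N))
    (G : ι → Idx M → Matrix (Idx N) (Idx M) K) (H : ι → Idx M → Matrix (Idx M) (Idx N) K)
    (ident : ∀ (d : Idx N) (X : Matrix (Idx N) (Idx N) K),
      ∑ b ∈ Finset.univ.filter (fun b : ι × Idx M => col b.1 b.2 = some d),
        G b.1 b.2 * ptrans b.2 (A b.1 X) * H b.1 b.2 = X)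
    (hlt : Fintype.card ι * 6 ^ M < 8 ^ N) :
    ∃ i c, col i c ≠ none ∧ ∀ ε : K, ∃ X, ptrans c (A i X) ≠ ε • A i X := by
  by_contra h
  simp only [not_exists, not_and, not_forall, ne_eq, not_not] at h
  exact absurd (eight_pow_le_card_mul_six_pow A col G H ident fun i c hic => h i c hic)
    (not_le.2 hlt)

/-! ## 3. Delay -/

/-- **CD ∧ SU delayed certificates: `8^N ≤ 6^(N+p)`.**  A ONE-copy column-disjoint sign-untwisted
certificate for `C₁^{⊠(N+p)} ⊵ ⟨2,2,2⟩^{⊠N}` (copies indexed by `PUnit`) forces `8^N ≤ 6^(N+p)`. -/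
theorem delay_linear_of_cdsu {p : ℕ}
    (A : PUnit.{v+1} → Matrix (Idx N) (Idx N) K →ₗ[K] Matrix (Idx (N + p)) (Idx (N + p)) K)
    (col : PUnit.{v+1} → Idx (N + p) → Option (Idx N))
    (G : PUnit.{v+1} → Idx (N + p) → Matrix (Idx N) (Idx (N + p)) K)
    (H : PUnit.{v+1} → Idx (N + p) → Matrix (Idx (N + p)) (Idx N) K)
    (ident : ∀ (d : Idx N) (X : Matrix (Idx N) (Idx N) K),
      ∑ b ∈ Finset.univ.filter (fun b : PUnit.{v+1} × Idx (N + p) => col b.1 b.2 = some d),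
        G b.1 b.2 * ptrans b.2 (A b.1 X) * H b.1 b.2 = X)
    (hSU : ∀ i c, col i c ≠ none → ∃ ε : K, ∀ X, ptrans c (A i X) = ε • A i X) :
    8 ^ N ≤ 6 ^ (N + p) := by
  have h := eight_pow_le_card_mul_six_pow A col G H ident hSU
  rwa [Fintype.card_punit, one_mul] at h

/-- **The delay RATE of the class**: `8^N ≤ 6^(N+p)` means `N · log (4/3) ≤ p · log 6`, i.e.
`p / N ≥ log (4/3) / log 6 = 0.16055…` — linear delay, whereas the leaf `BlockOneIsMM` is
EQUIVALENT to sublinear delay (`blockOneIsMM_iff_sublinearDelay`). -/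
theorem delay_rate_of_cdsu {N p : ℕ} (h : 8 ^ N ≤ 6 ^ (N + p)) :
    (N : ℝ) * Real.log (4 / 3) ≤ p * Real.log 6 := by
  have h' : ((8 : ℝ)) ^ N ≤ (6 : ℝ) ^ (N + p) := by exact_mod_cast h
  have hlog := Real.log_le_log (by positivity) h'
  rw [Real.log_pow, Real.log_pow, Nat.cast_add, add_mul] at hlog
  have h43 : Real.log (4 / 3) = Real.log 8 - Real.log 6 := by
    rw [← Real.log_div (by norm_num) (by norm_num)]; norm_num
  rw [h43, mul_sub]
  linarith

/-- Numerics: `6^8 < 8^7`, `6^15 < 8^13`, `6^4 ≥ 8^3` — so there is no CD ∧ SU certificate for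
`Delayed 7 1` or `Delayed 13 2`, while `Delayed 3 1` (instrument ask I-g26a) is not excluded by
this count. -/
theorem no_cdsu_delayed_seven_one : 6 ^ 8 < 8 ^ 7 ∧ 6 ^ 15 < 8 ^ 13 ∧ 8 ^ 3 ≤ 6 ^ 4 := by
  norm_num

end Summit.MatrixMultiplication.MatrixMultiplication.Theorems.OutsiderSandwichColumnDisjointDelay
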